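import Mathlib
import Summits.NavierStokesRegularity.NavierStokesRegularity.Theorems.FilamentSkeletonRssKelvinGateProjectedDatum

/-!
# Route `FilamentSkeletonRss` · crux `TransverseReduction1A` (stmt-27414; successor of the aside `TransverseReductionRJ`,
# stmt-21221) — line `kelvin_gate`: the PROJECTED DATUM `G = F − ∇Q` — weight, local Hölder modulus, weak incompressibility

Helper file (theorems only, `--as helper`).  HONEST FRAMING: analysis bookkeeping for a HYPOTHETICAL filament-type rotating
self-similar blow-up route; nothing here bears on Navier–Stokes regularity; no stub is proved here.

Continuation of `…KelvinGateProjectedDatum`.  For `F ∈ C¹(ℝ³; ℝ³)` with `(1+|y|)^{a+1}‖F‖ ≤ R`, `(1+|y|)^{a+1}‖DF‖ ≤ R`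
(`1 < a < 2`), `Q = Σⱼ T_{eⱼ}Fⱼ` the free pressure and `G = F − ∇Q` (both written out; no definitions):

* `rpow_weight_norm_sub_le_of_fderiv` — `(1+|x|)^a ‖F z − F x‖ ≤ 8 R |z−x|^{1/2}` for `2|z−x| ≤ 1+|x|` (mean value inequality on
  the ball `B̄(x, (1+|x|)/2)`, where `1 + |w| ≥ (1+|x|)/2`);
* `isWeaklyDivFree_projectedDatum` — **`G` is weakly divergence free**: for every test function `θ`,
  `∫⟨F − ∇Q, ∇θ⟩ = −∫θ div F + ∫ Q Δθ = 0` (`…FreePressure.integral_freePressure_mul_laplacian`: `ΔQ = div F` in `𝒟′`);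
* `projected_datum` — **package** `∃ C(a) ∀ F R`: `Q ∈ C¹`, `|Q| ≤ C R`, `(1+|x|)^a ‖∇Q‖ ≤ C R`; `G` continuous,
  `(1+|x|)^a ‖G‖ ≤ C R`, `(1+|x|)^a ‖G z − G x‖ ≤ C R |z−x|^{1/2}` (`2|z−x| ≤ 1+|x|`), `G` weakly divergence free —
  exactly the data class of `free_resolvent_weighted` (with `A₀ = A₁ = C R`, `β = ½`).
-/

set_option linter.dupNamespace false

noncomputable section

namespace Summit.NavierStokesRegularity.NavierStokesRegularity.Theorems.KelvinGate

open Set Function Filter MeasureTheory Metric Real InnerProductSpace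
open Literature.Analysis.FluidPDE Literature.Analysis.FluidPDE.NewtonPotentialHolder
open scoped ENNReal Topology Laplacian RealInnerProductSpace BigOperators

section ProjectedG

variable {F : EuclideanSpace ℝ (Fin 3) → EuclideanSpace ℝ (Fin 3)} {a R : ℝ}

/-! ## The datum itself: weighted local Lipschitz bound -/

/-- **`(1+|x|)^a ‖F z − F x‖ ≤ 8 R |z − x|^{1/2}`** for `2|z−x| ≤ 1+|x|`, when `(1+|y|)^{a+1}‖DF‖ ≤ R` (`0 ≤ a ≤ 2`). -/
theorem rpow_weight_norm_sub_le_of_fderiv (ha0 : 0 ≤ a) (ha2 : a ≤ 2) (hF : ContDiff ℝ 1 F)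
    (h1 : ∀ y, (1 + ‖y‖) ^ (a + 1) * ‖fderiv ℝ F y‖ ≤ R) (x z : EuclideanSpace ℝ (Fin 3))
    (hzx : 2 * ‖z - x‖ ≤ 1 + ‖x‖) :
    (1 + ‖x‖) ^ a * ‖F z - F x‖ ≤ 8 * R * ‖z - x‖ ^ (1 / 2 : ℝ) := by
  have hR : 0 ≤ R := le_trans (by positivity) (h1 0)
  have hx1 : 0 < 1 + ‖x‖ := by positivity
  have hxa1 : 0 < (1 + ‖x‖) ^ (a + 1) := by positivity
  -- on the ball `B̄(x, (1+|x|)/2)`: `‖DF w‖ ≤ 8R/(1+|x|)^{a+1}`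
  set s : Set (EuclideanSpace ℝ (Fin 3)) := closedBall x ((1 + ‖x‖) / 2) with hs
  have hbound : ∀ w ∈ s, ‖fderiv ℝ F w‖ ≤ 8 * R / (1 + ‖x‖) ^ (a + 1) := by
    intro w hw
    rw [hs, mem_closedBall, dist_eq_norm] at hw
    have hxw : 1 + ‖x‖ ≤ 2 * (1 + ‖w‖) := by
      have : ‖x‖ ≤ ‖w‖ + ‖w - x‖ := by
        calc ‖x‖ = ‖w - (w - x)‖ := by rw [sub_sub_cancel]
          _ ≤ ‖w‖ + ‖w - x‖ := norm_sub_le _ _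
      linarith
    have hpow : (1 + ‖x‖) ^ (a + 1) ≤ 8 * (1 + ‖w‖) ^ (a + 1) := by
      calc (1 + ‖x‖) ^ (a + 1) ≤ (2 * (1 + ‖w‖)) ^ (a + 1) := Real.rpow_le_rpow hx1.le hxw (by linarith)
        _ = (2:ℝ) ^ (a + 1) * (1 + ‖w‖) ^ (a + 1) := Real.mul_rpow zero_le_two (by positivity)
        _ ≤ (2:ℝ) ^ (3:ℝ) * (1 + ‖w‖) ^ (a + 1) :=
            mul_le_mul_of_nonneg_right (Real.rpow_le_rpow_of_exponent_le one_le_two (by linarith)) (by positivity)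
        _ = 8 * (1 + ‖w‖) ^ (a + 1) := by norm_num
    rw [le_div_iff₀ hxa1]
    calc ‖fderiv ℝ F w‖ * (1 + ‖x‖) ^ (a + 1) ≤ ‖fderiv ℝ F w‖ * (8 * (1 + ‖w‖) ^ (a + 1)) :=
          mul_le_mul_of_nonneg_left hpow (norm_nonneg _)
      _ = 8 * ((1 + ‖w‖) ^ (a + 1) * ‖fderiv ℝ F w‖) := by ring
      _ ≤ 8 * R := by nlinarith [h1 w]
  have hmvt : ‖F z - F x‖ ≤ 8 * R / (1 + ‖x‖) ^ (a + 1) * ‖z - x‖ :=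
    (convex_closedBall x _).norm_image_sub_le_of_norm_fderiv_le (fun w _ => (hF.differentiable one_ne_zero) w) hbound
      (mem_closedBall_self (by positivity)) (by rw [hs, mem_closedBall, dist_eq_norm]; linarith)
  -- `‖z − x‖ ≤ ‖z − x‖^{1/2} (1 + |x|)`
  have hsplit : ‖z - x‖ ≤ ‖z - x‖ ^ (1 / 2 : ℝ) * (1 + ‖x‖) := by
    have hzx1 : ‖z - x‖ ≤ 1 + ‖x‖ := by linarith [norm_nonneg (z - x)]
    have h12 : ‖z - x‖ ^ (1 / 2 : ℝ) ≤ (1 + ‖x‖) ^ (1 / 2 : ℝ) := Real.rpow_le_rpow (norm_nonneg _) hzx1 (by norm_num)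
    have h1x : (1 + ‖x‖) ^ (1 / 2 : ℝ) ≤ 1 + ‖x‖ := by
      calc (1 + ‖x‖) ^ (1 / 2 : ℝ) ≤ (1 + ‖x‖) ^ (1:ℝ) :=
            Real.rpow_le_rpow_of_exponent_le (by linarith [norm_nonneg x]) (by norm_num)
        _ = 1 + ‖x‖ := Real.rpow_one _
    have hhalf : ‖z - x‖ = ‖z - x‖ ^ (1 / 2 : ℝ) * ‖z - x‖ ^ (1 / 2 : ℝ) := by
      rw [← Real.rpow_add' (norm_nonneg _) (by norm_num)]; norm_num
    calc ‖z - x‖ = ‖z - x‖ ^ (1 / 2 : ℝ) * ‖z - x‖ ^ (1 / 2 : ℝ) := hhalf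
      _ ≤ ‖z - x‖ ^ (1 / 2 : ℝ) * (1 + ‖x‖) :=
          mul_le_mul_of_nonneg_left (h12.trans h1x) (Real.rpow_nonneg (norm_nonneg _) _)
  have hpow1 : (1 + ‖x‖) ^ (a + 1) = (1 + ‖x‖) ^ a * (1 + ‖x‖) := by
    rw [Real.rpow_add hx1, Real.rpow_one]
  calc (1 + ‖x‖) ^ a * ‖F z - F x‖ ≤ (1 + ‖x‖) ^ a * (8 * R / (1 + ‖x‖) ^ (a + 1) * ‖z - x‖) :=
        mul_le_mul_of_nonneg_left hmvt (by positivity)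
    _ ≤ (1 + ‖x‖) ^ a * (8 * R / (1 + ‖x‖) ^ (a + 1) * (‖z - x‖ ^ (1 / 2 : ℝ) * (1 + ‖x‖))) :=
        mul_le_mul_of_nonneg_left (mul_le_mul_of_nonneg_left hsplit (by positivity)) (by positivity)
    _ = 8 * R * ‖z - x‖ ^ (1 / 2 : ℝ) * (((1 + ‖x‖) ^ a * (1 + ‖x‖)) / (1 + ‖x‖) ^ (a + 1)) := by ring
    _ = 8 * R * ‖z - x‖ ^ (1 / 2 : ℝ) := by rw [← hpow1, div_self hxa1.ne', mul_one]

/-! ## Weak incompressibility of the projected datum -/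

/-- **`G = F − ∇Q` is weakly divergence free** for `F ∈ C¹` with `(1+|y|)²‖F‖ ≤ R₀`, `(1+|y|)²‖DF‖ ≤ R₁`
(quadratic weights suffice): `∫⟨F,∇θ⟩ = −∫θ div F` and `∫⟨∇Q,∇θ⟩ = −∫QΔθ = −∫θ div F` for test `θ`. -/
theorem isWeaklyDivFree_projectedDatum (hF : ContDiff ℝ 1 F) {R₀ R₁ : ℝ} (h0 : ∀ y, (1 + ‖y‖) ^ 2 * ‖F y‖ ≤ R₀)
    (h1 : ∀ y, (1 + ‖y‖) ^ 2 * ‖fderiv ℝ F y‖ ≤ R₁) :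
    IsWeaklyDivFree (fun x => F x - gradient (fun x => ∑ j : Fin 3,
      newtonGradPotential (EuclideanSpace.single j (1:ℝ)) (fun y => F y j) x) x) := by
  set Q : EuclideanSpace ℝ (Fin 3) → ℝ := fun x => ∑ j : Fin 3,
    newtonGradPotential (EuclideanSpace.single j (1:ℝ)) (fun y => F y j) x with hQ
  have hQ1 : ContDiff ℝ 1 Q := contDiff_one_freePressure hF h0 h1
  intro θ hθ
  have hθ3 : ContDiff ℝ 3 θ := hθ.contDiff.of_le (WithTop.coe_le_coe.mpr (le_top : ((3 : ℕ) : ℕ∞) ≤ ⊤))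
  have hθ2 : ContDiff ℝ 2 θ := hθ3.of_le (by norm_num)
  have hθ1 : ContDiff ℝ 1 θ := hθ3.of_le (by norm_num)
  have hθc : HasCompactSupport θ := hθ.hasCompactSupport
  -- `∇θ ∈ C¹_c`
  have hgradθ : ContDiff ℝ 1 (gradient θ) :=
    (InnerProductSpace.toDual ℝ (EuclideanSpace ℝ (Fin 3))).symm.contDiff.comp (hθ2.fderiv_right (m := 1) le_rfl)
  have hgradθc : HasCompactSupport (gradient θ) :=
    (hθc.fderiv (𝕜 := ℝ)).comp_left (g := (InnerProductSpace.toDual ℝ (EuclideanSpace ℝ (Fin 3))).symm) (map_zero _)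
  have hgradθcont : Continuous (gradient θ) := hgradθ.continuous
  -- `∫ θ div F + ∫⟨F, ∇θ⟩ = 0`
  have hIBP1 := integral_mul_divergence_add_eq_zero_left hθ1 hF hθc
  -- `∫ Q Δθ + ∫⟨∇θ, ∇Q⟩ = 0`
  have hIBP2 := integral_mul_divergence_add_eq_zero_right hQ1 hgradθ hgradθc
  have hdivgrad : ∀ x, VectorCalculus.divergence (gradient θ) x = (Δ θ) x := fun x => divergence_gradient hθ2 x
  simp only [hdivgrad] at hIBP2
  -- `∫ Q Δθ = ∫ θ div F`
  have hPoisson : ∫ x, Q x * (Δ θ) x = ∫ y, θ y * VectorCalculus.divergence F y :=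
    integral_freePressure_mul_laplacian hF h0 hθ3 hθc
  -- integrability of the two pairings
  have hI1 : Integrable (fun x => ⟪F x, gradient θ x⟫) (volume : Measure (EuclideanSpace ℝ (Fin 3))) :=
    (hF.continuous.inner hgradθcont).integrable_of_hasCompactSupport
      (hgradθc.mono fun x hx => by
        rw [Function.mem_support] at hx ⊢
        contrapose! hx
        rw [hx, inner_zero_right])
  have hI2 : Integrable (fun x => ⟪gradient Q x, gradient θ x⟫) (volume : Measure (EuclideanSpace ℝ (Fin 3))) :=
    ((continuous_gradient_of_contDiff hQ1).inner hgradθcont).integrable_of_hasCompactSupport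
      (hgradθc.mono fun x hx => by
        rw [Function.mem_support] at hx ⊢
        contrapose! hx
        rw [hx, inner_zero_right])
  have hcomm : ∫ x, ⟪gradient Q x, gradient θ x⟫ = ∫ x, ⟪gradient θ x, gradient Q x⟫ :=
    integral_congr_ae (Eventually.of_forall fun x => real_inner_comm _ _)
  calc ∫ x, ⟪F x - gradient Q x, gradient θ x⟫
      = ∫ x, (⟪F x, gradient θ x⟫ - ⟪gradient Q x, gradient θ x⟫) :=
        integral_congr_ae (Eventually.of_forall fun x => inner_sub_left _ _ _)
    _ = (∫ x, ⟪F x, gradient θ x⟫) - ∫ x, ⟪gradient Q x, gradient θ x⟫ := integral_sub hI1 hI2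
    _ = 0 := by rw [hcomm]; linarith

/-! ## The package -/

/-- **THE PROJECTED DATUM of a sharp `Y`-field.**  For `1 < a < 2` there is `C ≥ 0` such that for every `F ∈ C¹(ℝ³; ℝ³)` with
`(1+|y|)^{a+1}‖F‖ ≤ R` and `(1+|y|)^{a+1}‖DF‖ ≤ R`, the free pressure `Q = Σⱼ T_{eⱼ}Fⱼ` is `C¹` with `|Q| ≤ C R` and
`(1+|x|)^a ‖∇Q‖ ≤ C R`, and `G = F − ∇Q` is continuous with `(1+|x|)^a ‖G‖ ≤ C R`, has the `⟨x⟩^a`-weighted local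
`½`-modulus `(1+|x|)^a ‖G z − G x‖ ≤ C R |z−x|^{1/2}` (`2|z−x| ≤ 1+|x|`), and is weakly divergence free. -/
theorem projected_datum {a : ℝ} (ha1 : 1 < a) (ha2 : a < 2) :
    ∃ C : ℝ, 0 ≤ C ∧ ∀ (F : EuclideanSpace ℝ (Fin 3) → EuclideanSpace ℝ (Fin 3)) (R : ℝ), ContDiff ℝ 1 F →
      (∀ y, (1 + ‖y‖) ^ (a + 1) * ‖F y‖ ≤ R) → (∀ y, (1 + ‖y‖) ^ (a + 1) * ‖fderiv ℝ F y‖ ≤ R) →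
      ContDiff ℝ 1 (fun x => ∑ j : Fin 3, newtonGradPotential (EuclideanSpace.single j (1:ℝ)) (fun y => F y j) x) ∧
      (∀ x, |∑ j : Fin 3, newtonGradPotential (EuclideanSpace.single j (1:ℝ)) (fun y => F y j) x| ≤ C * R) ∧
      (∀ x, (1 + ‖x‖) ^ a * ‖gradient (fun x => ∑ j : Fin 3,
        newtonGradPotential (EuclideanSpace.single j (1:ℝ)) (fun y => F y j) x) x‖ ≤ C * R) ∧
      Continuous (fun x => F x - gradient (fun x => ∑ j : Fin 3,
        newtonGradPotential (EuclideanSpace.single j (1:ℝ)) (fun y => F y j) x) x) ∧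
      (∀ x, (1 + ‖x‖) ^ a * ‖F x - gradient (fun x => ∑ j : Fin 3,
        newtonGradPotential (EuclideanSpace.single j (1:ℝ)) (fun y => F y j) x) x‖ ≤ C * R) ∧
      (∀ x z, 2 * ‖z - x‖ ≤ 1 + ‖x‖ → (1 + ‖x‖) ^ a *
        ‖(F z - gradient (fun x => ∑ j : Fin 3, newtonGradPotential (EuclideanSpace.single j (1:ℝ)) (fun y => F y j) x) z) -
          (F x - gradient (fun x => ∑ j : Fin 3, newtonGradPotential (EuclideanSpace.single j (1:ℝ)) (fun y => F y j) x) x)‖ ≤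
        C * R * ‖z - x‖ ^ (1 / 2 : ℝ)) ∧
      IsWeaklyDivFree (fun x => F x - gradient (fun x => ∑ j : Fin 3,
        newtonGradPotential (EuclideanSpace.single j (1:ℝ)) (fun y => F y j) x) x) := by
  obtain ⟨C_H, hCH0, hH⟩ := rpow_weight_norm_fderiv_freePressure_sub_le ha1 ha2
  set V3 : ℝ := 3 * (volume : Measure (EuclideanSpace ℝ (Fin 3))).real (ball 0 1) with hV3
  have hV0 : 0 ≤ V3 := by positivity
  set C_Q : ℝ := 3 * (1 / (4 * π) * (12 * V3)) with hCQ
  have hCQ0 : 0 ≤ C_Q := by positivity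
  set C_D : ℝ := 3 * (1 / (4 * π) * (((2:ℝ) ^ a + 4 * (2:ℝ) ^ (2 - a) / (2 - a) + 4 * (2:ℝ) ^ (-a) / a) * V3)) with hCD
  have hCD0 : 0 ≤ C_D := by
    have h2a : 0 < 2 - a := by linarith
    have : 0 ≤ (2:ℝ) ^ a + 4 * (2:ℝ) ^ (2 - a) / (2 - a) + 4 * (2:ℝ) ^ (-a) / a := by positivity
    positivity
  refine ⟨C_Q + C_D + C_H + 9, by positivity, ?_⟩
  intro F R hF h0 h1
  have hR : 0 ≤ R := le_trans (by positivity) (h0 0)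
  have h0sq := sq_weight_mul_norm_le_of_rpow_weight ha1.le h0
  have h1sq := sq_weight_mul_norm_le_of_rpow_weight ha1.le h1
  set Q : EuclideanSpace ℝ (Fin 3) → ℝ := fun x => ∑ j : Fin 3,
    newtonGradPotential (EuclideanSpace.single j (1:ℝ)) (fun y => F y j) x with hQ
  have hQ1 : ContDiff ℝ 1 Q := contDiff_one_freePressure hF h0sq h1sq
  have hgrad : ∀ x, gradient Q x = (InnerProductSpace.toDual ℝ (EuclideanSpace ℝ (Fin 3))).symm (fderiv ℝ Q x) :=
    fun x => rfl
  have hgradc : Continuous (gradient Q) := continuous_gradient_of_contDiff hQ1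
  -- decay of `∇Q`
  have hDQ : ∀ x, (1 + ‖x‖) ^ a * ‖gradient Q x‖ ≤ C_D * R := by
    intro x
    rw [hgrad, LinearIsometryEquiv.norm_map]
    have h := rpow_weight_norm_fderiv_freePressure_le ha1 ha2 hF h0 h1 x
    rw [hCD]
    calc _ ≤ _ := h
      _ = _ := by ring
  -- each coefficient is at most `C`
  have hle : ∀ t : ℝ, 0 ≤ t → t ≤ C_Q + C_D + C_H + 9 → t * R ≤ (C_Q + C_D + C_H + 9) * R :=
    fun t _ ht => mul_le_mul_of_nonneg_right ht hR
  refine ⟨hQ1, fun x => ?_, fun x => ?_, hF.continuous.sub hgradc, fun x => ?_, fun x z hzx => ?_,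
    isWeaklyDivFree_projectedDatum hF h0sq h1sq⟩
  · -- `|Q| ≤ C_Q R`
    have h := abs_freePressure_le h0sq x
    have hx : (1:ℝ) ≤ 1 + ‖x‖ := by linarith [norm_nonneg x]
    have h2 : 3 * (R / (4 * π) * (12 * V3 / (1 + ‖x‖))) ≤ C_Q * R := by
      have : 12 * V3 / (1 + ‖x‖) ≤ 12 * V3 := div_le_self (by positivity) hx
      have hR4 : 0 ≤ R / (4 * π) := by positivity
      calc 3 * (R / (4 * π) * (12 * V3 / (1 + ‖x‖))) ≤ 3 * (R / (4 * π) * (12 * V3)) :=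
            mul_le_mul_of_nonneg_left (mul_le_mul_of_nonneg_left this hR4) (by norm_num)
        _ = C_Q * R := by rw [hCQ]; ring
    exact (h.trans h2).trans (hle _ hCQ0 (by linarith))
  · exact (hDQ x).trans (hle _ hCD0 (by linarith))
  · -- `(1+|x|)^a ‖G x‖ ≤ (1 + C_D) R`
    have hxa : (1 + ‖x‖) ^ a ≤ (1 + ‖x‖) ^ (a + 1) :=
      Real.rpow_le_rpow_of_exponent_le (by linarith [norm_nonneg x]) (by linarith)
    have hFx : (1 + ‖x‖) ^ a * ‖F x‖ ≤ R :=
      le_trans (mul_le_mul_of_nonneg_right hxa (norm_nonneg _)) (h0 x)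
    calc (1 + ‖x‖) ^ a * ‖F x - gradient Q x‖ ≤ (1 + ‖x‖) ^ a * (‖F x‖ + ‖gradient Q x‖) :=
          mul_le_mul_of_nonneg_left (norm_sub_le _ _) (by positivity)
      _ = (1 + ‖x‖) ^ a * ‖F x‖ + (1 + ‖x‖) ^ a * ‖gradient Q x‖ := by ring
      _ ≤ R + C_D * R := add_le_add hFx (hDQ x)
      _ = (1 + C_D) * R := by ring
      _ ≤ (C_Q + C_D + C_H + 9) * R := hle _ (by positivity) (by linarith)
  · -- local modulus of `G`
    have hF' := rpow_weight_norm_sub_le_of_fderiv (by linarith) ha2.le hF h1 x z hzx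
    have hQ' := hH F R hF h0 h1 x z hzx
    have hgsub : gradient Q z - gradient Q x =
        (InnerProductSpace.toDual ℝ (EuclideanSpace ℝ (Fin 3))).symm (fderiv ℝ Q z - fderiv ℝ Q x) := by
      rw [map_sub, ← hgrad, ← hgrad]
    have hQ'' : (1 + ‖x‖) ^ a * ‖gradient Q z - gradient Q x‖ ≤ C_H * R * ‖z - x‖ ^ (1 / 2 : ℝ) := by
      rw [hgsub, LinearIsometryEquiv.norm_map]; exact hQ'
    have hzr : 0 ≤ ‖z - x‖ ^ (1 / 2 : ℝ) := Real.rpow_nonneg (norm_nonneg _) _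
    calc (1 + ‖x‖) ^ a * ‖(F z - gradient Q z) - (F x - gradient Q x)‖
        = (1 + ‖x‖) ^ a * ‖(F z - F x) - (gradient Q z - gradient Q x)‖ := by congr 2; abel
      _ ≤ (1 + ‖x‖) ^ a * (‖F z - F x‖ + ‖gradient Q z - gradient Q x‖) :=
          mul_le_mul_of_nonneg_left (norm_sub_le _ _) (by positivity)
      _ = (1 + ‖x‖) ^ a * ‖F z - F x‖ + (1 + ‖x‖) ^ a * ‖gradient Q z - gradient Q x‖ := by ring
      _ ≤ 8 * R * ‖z - x‖ ^ (1 / 2 : ℝ) + C_H * R * ‖z - x‖ ^ (1 / 2 : ℝ) := add_le_add hF' hQ''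
      _ = ((8 + C_H) * R) * ‖z - x‖ ^ (1 / 2 : ℝ) := by ring
      _ ≤ ((C_Q + C_D + C_H + 9) * R) * ‖z - x‖ ^ (1 / 2 : ℝ) :=
          mul_le_mul_of_nonneg_right (hle _ (by positivity) (by linarith)) hzr
      _ = (C_Q + C_D + C_H + 9) * R * ‖z - x‖ ^ (1 / 2 : ℝ) := by ring

end ProjectedG

end Summit.NavierStokesRegularity.NavierStokesRegularity.Theorems.KelvinGate

end
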